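import Summits.NavierStokesRegularity.NavierStokesRegularity.Theorems.NoOverheating.Negative.SlowScrewWindowsExcluded

/-!
# KJ-40 — window profiles with a HIDDEN ROTATED self-similarity are excluded at EVERY window
# (Pineau–Vicol 2026 regimes (i)/(ii), reached through a hidden factor near one)

Refuter lineage, Negative lane of crux K2 `NoOverheating` of route `AngularGalerkinLadder`
(supports, does not decide).  The census KJ-38/KJ-39 left two escapes for an admissible window
sequence: Pineau–Vicol's open middle range of angular speeds, and COARSE windows (`cmax^q ≥ κ(C₀),
c₁(C₀)` for every usable power `q`).  The coarse-window escape is closed for profiles carrying MORE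
scaling symmetry than the pair `(cₙ, Rₙ)` declared in the window: for EXACTLY self-similar profiles
and for a common hidden plain-DSS factor this is `SelfSimilarWindowsExcluded`
(`no_windowSequence_extraFineFactor`, `no_selfSimilar_windowSequence`, circuit lineage); this file
does the ROTATED case.

* `isWindowProfile_redeclare`: the window predicate sees `(c, R)` only through `1 < c`,
  `(c, R)`-RDSS and `cmin ≤ c ≤ cmax`; a profile that is ALSO `(μ, S)`-RDSS with `1 < μ` is a window
  profile for the data `(μ, S)` in the one-point window `[μ, μ]`, with the same rung equation,
  Type-I constant, amplitude floor and defect bound.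
* `no_windowSequence_hiddenRSS_slow` / `_fast`: for every `C₀` there are `α₁ > 0`, `α₂ > 0`
  (Pineau–Vicol 2026, Thm 1.7 (i)/(ii)) such that NO admissible window sequence — any window
  `[cmin, cmax]`, however coarse, any declared rotations — consists of profiles that are ROTATED
  self-similar about some axis `gₙe₃` with angular speed `αₙ` (`(μ, gₙ R_{2αₙ log μ} gₙ⁻¹)`-RDSS for
  every `μ > 1`; Bradshaw–Tsai 2017 (v-RSS), Pineau–Vicol 2026 (1.7)) with `|αₙ| ≤ α₁`, resp.
  `α₂ ≤ |αₙ| ≤ A`: through a hidden factor `μ` near `1` these are slow, resp. fast-and-fine, screws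
  with bounded angles, killed by `no_windowSequence_slowScrew` / `no_windowSequence_fastScrew`
  (KJ-35).  This is the window-sequence form of Pineau–Vicol's Theorem 1.4 (RSS Liouville), reached
  here through Theorem 1.7 exactly as the paper's Remark 1.5 indicates.
* §3 reads this on the open cruxes: `RungBlowupCofinal` together with a `NoOverheating` met by
  hidden-RSS window profiles in either regime is contradictory, for every window.

WHAT ESCAPES: hidden RSS with speeds in the open middle range `α₁ < |αₙ| < α₂`, or unbounded speeds
along the sequence.  WHAT THIS IS NOT: not `¬NoOverheating`; no new Literature fact, no definition;
standard axioms only.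
[cite: PineauVicol2026, Theorem 1.4, Remark 1.5 and Theorem 1.7 (i)–(ii) (arXiv:2607.09619 pp. 4–7)]
[cite: BradshawTsai2017CPDE, §1 (v-RSS) (arXiv:1610.05680 p. 3)] -/

namespace Summit.NavierStokesRegularity.AngularGalerkinLadderHiddenRSSWindowsExcluded

open Set Filter MeasureTheory Topology Function
open Literature.Analysis Literature.Analysis.FluidPDE
open Summit.NavierStokesRegularity.FluidComputer
open Summit.NavierStokesRegularity.NavierStokesRegularity.Theses.AngularGalerkinLadder
open Summit.NavierStokesRegularity.AngularGalerkinLadderSlowScrewWindowsExcluded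

/-! ### §1 Re-declaring the self-similarity data of a window profile -/

/-- **The window predicate is blind to hidden symmetry.**  A window rung profile for the data
`(c, R)` in `[cmin, cmax]` which is also `(μ, S)`-RDSS with `1 < μ` is a window rung profile for the
data `(μ, S)` in the window `[μ, μ]` (same rung equation, constant, floor and defect bound).
[cite: BradshawTsai2017CPDE, §1] -/
theorem isWindowProfile_redeclare {L : ℕ} {C₀ cmin cmax δ ε c μ : ℝ}
    {R S : EuclideanSpace ℝ (Fin 3) ≃ₗᵢ[ℝ] EuclideanSpace ℝ (Fin 3)}
    {u : ℝ → EuclideanSpace ℝ (Fin 3) → EuclideanSpace ℝ (Fin 3)}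
    {p : ℝ → EuclideanSpace ℝ (Fin 3) → ℝ}
    {d : ℝ → EuclideanSpace ℝ (Fin 3) → EuclideanSpace ℝ (Fin 3)} (hμ : 1 < μ)
    (hW : AngularLadder.IsWindowProfile L C₀ cmin cmax δ ε c R u p d) (hS : IsRotatedDSS μ S u) :
    AngularLadder.IsWindowProfile L C₀ μ μ δ ε μ S u p d := by
  obtain ⟨⟨hsol, -, -, hTI⟩, -, -, hamp, hdef⟩ := hW
  exact ⟨⟨hsol, hμ, hS, hTI⟩, le_rfl, le_rfl, hamp, hdef⟩

/-! ### §2 Hidden rotated self-similarity (Pineau–Vicol's regimes through a factor near one) -/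

/-- **No admissible window sequence of hidden-RSS profiles with SLOW angular speeds — any window.**
For every `C₀` there is `α₁ > 0` (Pineau–Vicol 2026, Thm 1.7 (i)) such that: constants `0 < δ`,
`εₙ → 0`, any window and declared rotations, a window rung profile with constant `C₀` at every index
which is rotated self-similar about an axis `gₙe₃` with angular speed `αₙ`
(`(μ, gₙ R_{2αₙ log μ} gₙ⁻¹)`-RDSS for every `μ > 1`), and `|αₙ| ≤ α₁`, are contradictory: at the
hidden factor `μ = (1 + c₁)/2 < c₁(C₀)` the profiles are slow screws, `|2αₙ log μ| ≤ 2 α₁ log μ`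
(`no_windowSequence_slowScrew`).
[cite: PineauVicol2026, Theorem 1.4 and Theorem 1.7 (i) (arXiv:2607.09619 pp. 4, 7)]
[cite: BradshawTsai2017CPDE, §1 (v-RSS)] -/
theorem no_windowSequence_hiddenRSS_slow (C₀ : ℝ) :
    ∃ α₁ : ℝ, 0 < α₁ ∧ ∀ {cmin cmax δ : ℝ} {L : ℕ → ℕ} {ε c α : ℕ → ℝ}
      {R g : ℕ → (EuclideanSpace ℝ (Fin 3) ≃ₗᵢ[ℝ] EuclideanSpace ℝ (Fin 3))}
      {u : ℕ → ℝ → EuclideanSpace ℝ (Fin 3) → EuclideanSpace ℝ (Fin 3)}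
      {p : ℕ → ℝ → EuclideanSpace ℝ (Fin 3) → ℝ}
      {d : ℕ → ℝ → EuclideanSpace ℝ (Fin 3) → EuclideanSpace ℝ (Fin 3)},
      0 < δ → Tendsto ε atTop (𝓝 0) →
      (∀ n, AngularLadder.IsWindowProfile (L n) C₀ cmin cmax δ (ε n) (c n) (R n) (u n) (p n)
        (d n)) →
      (∀ n (μ : ℝ), 1 < μ → IsRotatedDSS μ
        (((g n).symm.trans (rotZLIE (2 * α n * Real.log μ))).trans (g n)) (u n)) →
      (∀ n, |α n| ≤ α₁) → False := by
  obtain ⟨α₁, hα₁, c₁, hc₁, H⟩ := no_windowSequence_slowScrew C₀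
  refine ⟨α₁, hα₁, fun {cmin cmax δ L ε c α R g u p d} hδ hε hW hRSS hα => ?_⟩
  obtain ⟨μ, hμ, hμc⟩ : ∃ μ : ℝ, 1 < μ ∧ μ < c₁ := ⟨(1 + c₁) / 2, by linarith, by linarith⟩
  have hlog : 0 < Real.log μ := Real.log_pos hμ
  refine H (c := fun _ => μ) (θ := fun n => 2 * α n * Real.log μ) (g := g)
    (R := fun n => ((g n).symm.trans (rotZLIE (2 * α n * Real.log μ))).trans (g n))
    hμc hμ hδ hε (fun n => isWindowProfile_redeclare hμ (hW n) (hRSS n μ hμ)) (fun n x => rfl)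
    fun n => ?_
  show |2 * α n * Real.log μ| ≤ 2 * α₁ * Real.log μ
  rw [abs_mul, abs_mul, abs_of_pos hlog, abs_two]
  gcongr
  exact hα n

/-- **No admissible window sequence of hidden-RSS profiles with FAST, BOUNDED angular speeds — any
window.**  For every `C₀` there is `α₂ > 0` (Pineau–Vicol 2026, Thm 1.7 (ii)) such that for every
bound `A`: constants `0 < δ`, `εₙ → 0`, any window and declared rotations, hidden-RSS window rung
profiles with constant `C₀` and speeds `α₂ ≤ |αₙ| ≤ A` are contradictory: at a hidden factor
`μ > 1` with `(1 + A²) log μ < log c₂(C₀)` the profiles are fast, fine screws with bounded angles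
(`no_windowSequence_fastScrew`).
[cite: PineauVicol2026, Theorem 1.4 and Theorem 1.7 (ii) (arXiv:2607.09619 pp. 4, 7)]
[cite: BradshawTsai2017CPDE, §1 (v-RSS)] -/
theorem no_windowSequence_hiddenRSS_fast (C₀ : ℝ) :
    ∃ α₂ : ℝ, 0 < α₂ ∧ ∀ (A : ℝ) {cmin cmax δ : ℝ} {L : ℕ → ℕ} {ε c α : ℕ → ℝ}
      {R g : ℕ → (EuclideanSpace ℝ (Fin 3) ≃ₗᵢ[ℝ] EuclideanSpace ℝ (Fin 3))}
      {u : ℕ → ℝ → EuclideanSpace ℝ (Fin 3) → EuclideanSpace ℝ (Fin 3)}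
      {p : ℕ → ℝ → EuclideanSpace ℝ (Fin 3) → ℝ}
      {d : ℕ → ℝ → EuclideanSpace ℝ (Fin 3) → EuclideanSpace ℝ (Fin 3)},
      0 < δ → Tendsto ε atTop (𝓝 0) →
      (∀ n, AngularLadder.IsWindowProfile (L n) C₀ cmin cmax δ (ε n) (c n) (R n) (u n) (p n)
        (d n)) →
      (∀ n (μ : ℝ), 1 < μ → IsRotatedDSS μ
        (((g n).symm.trans (rotZLIE (2 * α n * Real.log μ))).trans (g n)) (u n)) →
      (∀ n, α₂ ≤ |α n|) → (∀ n, |α n| ≤ A) → False := by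
  obtain ⟨α₂, hα₂, c₂, hc₂, H⟩ := no_windowSequence_fastScrew C₀
  refine ⟨α₂, hα₂, fun A {cmin cmax δ L ε c α R g u p d} hδ hε hW hRSS hlow hA => ?_⟩
  have hc₂log : 0 < Real.log c₂ := Real.log_pos hc₂
  have hA2 : 0 < 1 + A ^ 2 := by positivity
  obtain ⟨μ, hμ, hμℓ⟩ : ∃ μ : ℝ, 1 < μ ∧ (1 + A ^ 2) * Real.log μ < Real.log c₂ := by
    have hpos : 0 < Real.log c₂ / (2 * (1 + A ^ 2)) := div_pos hc₂log (by positivity)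
    refine ⟨Real.exp (Real.log c₂ / (2 * (1 + A ^ 2))), ?_, ?_⟩
    · have := Real.add_one_lt_exp hpos.ne'
      linarith
    · rw [Real.log_exp]
      have : (1 + A ^ 2) * (Real.log c₂ / (2 * (1 + A ^ 2))) = Real.log c₂ / 2 := by
        field_simp
      rw [this]
      linarith
  have hlog : 0 < Real.log μ := Real.log_pos hμ
  refine H (c := fun _ => μ) (θ := fun n => 2 * α n * Real.log μ) (Θ := 2 * A * Real.log μ)
    (ℓ := (1 + A ^ 2) * Real.log μ) (g := g)
    (R := fun n => ((g n).symm.trans (rotZLIE (2 * α n * Real.log μ))).trans (g n))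
    hμℓ hμ hδ hε (fun n => isWindowProfile_redeclare hμ (hW n) (hRSS n μ hμ)) (fun n x => rfl)
    (fun n => ?_) (fun n => ?_) fun n => ?_
  · show |2 * α n * Real.log μ| ≤ 2 * A * Real.log μ
    rw [abs_mul, abs_mul, abs_of_pos hlog, abs_two]
    gcongr
    exact hA n
  · show 2 * α₂ * Real.log μ ≤ |2 * α n * Real.log μ|
    rw [abs_mul, abs_mul, abs_of_pos hlog, abs_two]
    gcongr
    exact hlow n
  · show (1 + (2 * α n * Real.log μ / (2 * Real.log μ)) ^ 2) * Real.log μ ≤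
      (1 + A ^ 2) * Real.log μ
    have hq : 2 * α n * Real.log μ / (2 * Real.log μ) = α n := by
      field_simp
    have hsq : (α n) ^ 2 ≤ A ^ 2 := by
      rw [← sq_abs (α n)]
      exact pow_le_pow_left₀ (abs_nonneg _) (hA n) 2
    rw [hq]
    exact mul_le_mul_of_nonneg_right (by linarith) hlog.le

/-! ### §3 Read on the open cruxes -/

/-- **K1 ∧ (K2 met by hidden-RSS window profiles with slow speeds) is FALSE — any window.**  For
every `C₀` there is `α₁ > 0` such that `RungBlowupCofinal` and a supply of window rung profiles,
constant `C₀`, any window, each rotated self-similar about some axis with speed `|α| ≤ α₁`, are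
contradictory. [cite: PineauVicol2026, Theorem 1.4 and Theorem 1.7 (i)] -/
theorem not_cofinal_and_noOverheating_hiddenRSS_slow (C₀ : ℝ) :
    ∃ α₁ : ℝ, 0 < α₁ ∧ ¬ (RungBlowupCofinal ∧
      ∃ (cmin cmax δ : ℝ) (L₀ : ℕ) (ε : ℕ → ℝ), 0 < δ ∧ Tendsto ε atTop (𝓝 0) ∧
        ∀ L ≥ L₀, AngularLadder.RungIsSingular L →
          ∃ (c : ℝ) (R : EuclideanSpace ℝ (Fin 3) ≃ₗᵢ[ℝ] EuclideanSpace ℝ (Fin 3))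
            (u : ℝ → EuclideanSpace ℝ (Fin 3) → EuclideanSpace ℝ (Fin 3))
            (p : ℝ → EuclideanSpace ℝ (Fin 3) → ℝ)
            (d : ℝ → EuclideanSpace ℝ (Fin 3) → EuclideanSpace ℝ (Fin 3))
            (g : EuclideanSpace ℝ (Fin 3) ≃ₗᵢ[ℝ] EuclideanSpace ℝ (Fin 3)) (α : ℝ),
            AngularLadder.IsWindowProfile L C₀ cmin cmax δ (ε L) c R u p d ∧
              (∀ μ : ℝ, 1 < μ →
                IsRotatedDSS μ ((g.symm.trans (rotZLIE (2 * α * Real.log μ))).trans g) u) ∧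
              |α| ≤ α₁) := by
  obtain ⟨α₁, hα₁, H⟩ := no_windowSequence_hiddenRSS_slow C₀
  refine ⟨α₁, hα₁, ?_⟩
  rintro ⟨h₁, cmin, cmax, δ, L₀, ε, hδ, hε, hwin⟩
  choose L hLge hLsing using fun n : ℕ => h₁ (max L₀ n)
  choose c R u p d g α hW hRSS hα using fun n : ℕ =>
    hwin (L n) (le_trans (le_max_left _ _) (hLge n)) (hLsing n)
  have hε' : Tendsto (fun n : ℕ => ε (L n)) atTop (𝓝 0) :=
    hε.comp (tendsto_atTop_mono (fun n => le_trans (le_max_right _ _) (hLge n)) tendsto_id)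
  exact H hδ hε' hW hRSS hα

/-- Census edge on K1: a `NoOverheating`-type supply of hidden-RSS window profiles with slow
speeds `|α| ≤ α₁(C₀)` (any window) refutes `RungBlowupCofinal`.
[cite: PineauVicol2026, Theorem 1.4 and Theorem 1.7 (i)] -/
theorem rungBlowupCofinal_false_of_noOverheating_hiddenRSS_slow (C₀ : ℝ) :
    ∃ α₁ : ℝ, 0 < α₁ ∧ ∀ {cmin cmax δ : ℝ} {L₀ : ℕ} {ε : ℕ → ℝ},
      0 < δ → Tendsto ε atTop (𝓝 0) →
      (∀ L ≥ L₀, AngularLadder.RungIsSingular L →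
        ∃ (c : ℝ) (R : EuclideanSpace ℝ (Fin 3) ≃ₗᵢ[ℝ] EuclideanSpace ℝ (Fin 3))
          (u : ℝ → EuclideanSpace ℝ (Fin 3) → EuclideanSpace ℝ (Fin 3))
          (p : ℝ → EuclideanSpace ℝ (Fin 3) → ℝ)
          (d : ℝ → EuclideanSpace ℝ (Fin 3) → EuclideanSpace ℝ (Fin 3))
          (g : EuclideanSpace ℝ (Fin 3) ≃ₗᵢ[ℝ] EuclideanSpace ℝ (Fin 3)) (α : ℝ),
          AngularLadder.IsWindowProfile L C₀ cmin cmax δ (ε L) c R u p d ∧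
            (∀ μ : ℝ, 1 < μ →
              IsRotatedDSS μ ((g.symm.trans (rotZLIE (2 * α * Real.log μ))).trans g) u) ∧
            |α| ≤ α₁) →
      ¬ RungBlowupCofinal := by
  obtain ⟨α₁, hα₁, H⟩ := not_cofinal_and_noOverheating_hiddenRSS_slow C₀
  exact ⟨α₁, hα₁, fun {cmin cmax δ L₀ ε} hδ hε hwin h₁ =>
    H ⟨h₁, cmin, cmax, δ, L₀, ε, hδ, hε, hwin⟩⟩

/-- **K1 ∧ (K2 met by hidden-RSS window profiles with fast, bounded speeds) is FALSE — any
window.** [cite: PineauVicol2026, Theorem 1.4 and Theorem 1.7 (ii)] -/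
theorem not_cofinal_and_noOverheating_hiddenRSS_fast (C₀ : ℝ) :
    ∃ α₂ : ℝ, 0 < α₂ ∧ ∀ A : ℝ, ¬ (RungBlowupCofinal ∧
      ∃ (cmin cmax δ : ℝ) (L₀ : ℕ) (ε : ℕ → ℝ), 0 < δ ∧ Tendsto ε atTop (𝓝 0) ∧
        ∀ L ≥ L₀, AngularLadder.RungIsSingular L →
          ∃ (c : ℝ) (R : EuclideanSpace ℝ (Fin 3) ≃ₗᵢ[ℝ] EuclideanSpace ℝ (Fin 3))
            (u : ℝ → EuclideanSpace ℝ (Fin 3) → EuclideanSpace ℝ (Fin 3))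
            (p : ℝ → EuclideanSpace ℝ (Fin 3) → ℝ)
            (d : ℝ → EuclideanSpace ℝ (Fin 3) → EuclideanSpace ℝ (Fin 3))
            (g : EuclideanSpace ℝ (Fin 3) ≃ₗᵢ[ℝ] EuclideanSpace ℝ (Fin 3)) (α : ℝ),
            AngularLadder.IsWindowProfile L C₀ cmin cmax δ (ε L) c R u p d ∧
              (∀ μ : ℝ, 1 < μ →
                IsRotatedDSS μ ((g.symm.trans (rotZLIE (2 * α * Real.log μ))).trans g) u) ∧
              α₂ ≤ |α| ∧ |α| ≤ A) := by
  obtain ⟨α₂, hα₂, H⟩ := no_windowSequence_hiddenRSS_fast C₀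
  refine ⟨α₂, hα₂, fun A => ?_⟩
  rintro ⟨h₁, cmin, cmax, δ, L₀, ε, hδ, hε, hwin⟩
  choose L hLge hLsing using fun n : ℕ => h₁ (max L₀ n)
  choose c R u p d g α hW hRSS hlow hA using fun n : ℕ =>
    hwin (L n) (le_trans (le_max_left _ _) (hLge n)) (hLsing n)
  have hε' : Tendsto (fun n : ℕ => ε (L n)) atTop (𝓝 0) :=
    hε.comp (tendsto_atTop_mono (fun n => le_trans (le_max_right _ _) (hLge n)) tendsto_id)
  exact H A hδ hε' hW hRSS hlow hA

end Summit.NavierStokesRegularity.AngularGalerkinLadderHiddenRSSWindowsExcluded
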